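import Mathlib.FieldTheory.Galois.Basic
import Mathlib.FieldTheory.KummerExtension
import Mathlib.FieldTheory.SeparableClosure
import Mathlib.RingTheory.PrincipalIdealDomain
import Mathlib.Data.Nat.Prime.Int
import HarnessLib

/-!
# X11b — the TWIST-INTERSECTION LEMMA of Kummer theory (every `p`; pure field theory):
# `⋂_{(η_i)} F(η_1 x_1, …, η_m x_m) = F` for `x_i^{p^{a_i}} ∈ F^×`, `η_i` running over the
# `p^{a_i}`-th roots of unity, PROVIDED `F` has no primitive `p`-th root of unity

HONEST FRAMING (cell `b2b-bsdres`, run/shared/lean/b2b/bsd-rank1-residual/, verbatim in every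
file): the goal of the cell is to DELETE the COMBINATION-SHAPED residual classes of the
Birch–Swinnerton-Dyer formula for ALL analytic-rank `≤ 1` elliptic curves over `ℚ` — "full BSD
formula for every rank `≤ 1` curve in class `C`" assembled STRICTLY from published theorems — so
that the rank-`≤ 1` remainder becomes exactly the CONSTRUCTION-SHAPED classes, which are TYPED
(missing-input `Prop`s), NOT attempted. This is not "finishing BSD". Sub-cell
`b2b-bsdres-multr1-p1` (X11b, route R1, gen 24); THEOREMS ONLY (no definition, no named fact, no
`sorry`); PURE FIELD THEORY valid for every prime `p` and any fields — nothing `p`-adic, nothing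
about any curve. It is the KERNEL form of STEP B of `HOME/b2b-bsdres-multr1-p1/DESCENT-NOTE.md`
(the `R₀`-descent behind Castella 2018, p. 9 ll. 42–47, "`L_p(f) := Tw_{ψ⁻¹}(ℒ_{𝔭,ψ}(f)) ∈ Λ_{R₀}`",
flagged by x11b3-lit1 L59/L63 and asked about in x11b3-lead R8-15 (c): "twist-intersection Lemma
as a kernel theorem"), with a SHORTER proof and a WEAKER hypothesis than the note's.

## The lemma and its proof

Let `p` be a prime and `F` a field with NO primitive `p`-th root of unity (`z^p = 1 ⟹ z = 1`;
automatic for `F = Frac W(𝔽̄_p) = \widehat{ℚ_p^ur}` and `p` odd, NOT proved here; false for `p = 2`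
unless `char F = 2`). Let `E ⊇ F` contain a primitive `p^A`-th root of unity `ζ`, let `a_i ≤ A`,
`u_i ∈ F^×`, `x_i ∈ E` with `x_i^{p^{a_i}} = u_i` (finitely many `i`). THEN: an element of `E` lying
in `F((η_i x_i)_i)` for EVERY tuple of `p^{a_i}`-th roots of unity `η_i` lies in `F`
(`R1.mem_bot_of_forall_mem_adjoin_kummer_twists`; one radical:
`R1.mem_bot_of_forall_mem_adjoin_rootOfUnity_mul`, `R1.iInf_adjoin_rootOfUnity_mul_eq_bot`; inside
an ambient field such as `ℂ_p`, with `F` a `Subfield`: `R1.mem_subfield_of_forall_mem_closure`).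

PROOF (affine action; `R1.forall_apply_eq_of_kummer_twists`). `V := F(ζ, (x_i)_i)` is the
splitting field of `(X^{p^A} − 1)∏_i(X^{p^{a_i}} − u_i)`, finite Galois over `F` (separable since
`p ≠ char F`, which the existence of `ζ` forces when `A ≥ 1`; `A = 0` is trivial). For
`g ∈ Gal(V/F)`: `gζ = ζ^c`, `g x_i = ζ_i^{d_i} x_i` (`ζ_i := ζ^{p^{A−a_i}}`), so
`g(ζ_i^t x_i) = ζ_i^{ct+d_i} x_i`. If `g` MOVES `ζ_p := ζ^{p^{A−1}}` then `p ∤ c − 1`, each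
congruence `(c−1)t_i + d_i ≡ 0 (mod p^{a_i})` is solvable (Bézout), and `g` FIXES the whole
tuple `(ζ_i^{t_i} x_i)_i`, hence the field it generates,
hence `y`. The `g` FIXING `ζ_p` form a PROPER subgroup (`ζ_p ∉ F` and `V/F` Galois), and the
complement of a proper subgroup generates the group (`R1.subgroup_eq_top_of_forall_not_mem`); so
every `g` fixes `y` and `y ∈ F` (`IsGalois.mem_bot_iff_fixed`). ∎ — The note's Step B (i)–(iii)
(Capelli, linear disjointness from `F(μ_{p^∞})`, an `h` with `χ(h) = 2`) is not needed, and its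
hypothesis "`[F(μ_{p^a}) : F] = φ(p^a)`" weakens to "`ζ_p ∉ F`".

## What this file does NOT do

Nothing about `R₀ = unrIntegers p ⊂ ℂ_p` is proved: to run the descent of COEFFICIENTS at a prime
`p` (gen 23's `R1.coeff_mem_of_hasValueAt_mem` per twist, then this file) one needs `Frac R₀`
closed in `ℂ_p` with `ζ_p ∉ Frac R₀` — i.e. that the closure of `ℤ[μ_{p'}]` in `ℂ_p` is the
valuation ring of a complete DISCRETELY valued subfield with uniformizer `p` (unramifiedness of
`ℚ_p(μ_m)`, `p ∤ m`). That is infrastructure about the tree's `unrIntegers`, not in the tree, not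
attempted here, and not load-bearing for route R1 (whose open input is `R₀`-free since gen 23,
`RouteR1IntFrame.lean`). At `p = 3` (team x11b3, non-owning remark): with lit1 L63's (W₃) and the
printed twist-uniformity (n1), this lemma with `m = 1`, `u = λ̂(γ)^{3^c}… ∈ 1 + 3ℤ₃`, is the
"half-page field-theory lemma" of the (t1) gloss; nothing of `Three.` is touched or claimed.

References: [Castella2018] F. Castella, Camb. J. Math. 6 (2018), p. 9 ll. 42–47 (arXiv:1704.06608)
(the twist `Tw_{ψ⁻¹}`); [CastellaHsieh2018] Math. Ann. 370, Def. 3.5 (the ring `𝒲`); [Lang2002]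
S. Lang, *Algebra*, 3rd ed., VI §6 (cyclic/Kummer extensions), VI §1 (Galois correspondence) — the
lemma itself is folklore field theory.
-/

noncomputable section

open scoped Classical

open Polynomial IntermediateField

namespace Summit.BirchSwinnertonDyer.Rank1Residual.X11b

/-! ### §1 Two elementary lemmas -/

section Elementary

/-- **A subgroup containing the complement of a PROPER subgroup is the whole group**: if `H ≠ ⊤`
and every `g ∉ H` lies in `S`, then `S = ⊤` (for `g ∈ H` pick `h ∉ H`; then `gh ∉ H`, so
`g = (gh)h⁻¹ ∈ S`). [folklore] -/
theorem R1.subgroup_eq_top_of_forall_not_mem {G : Type*} [Group G] {H S : Subgroup G}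
    (hH : H ≠ ⊤) (hS : ∀ g, g ∉ H → g ∈ S) : S = ⊤ := by
  obtain ⟨h, hh⟩ : ∃ h, h ∉ H := by
    by_contra! hall
    exact hH (eq_top_iff.mpr fun g _ ↦ hall g)
  refine eq_top_iff.mpr fun g _ ↦ ?_
  by_cases hg : g ∈ H
  · have hgh : g * h ∉ H := fun hgh ↦ hh (by simpa using H.mul_mem (H.inv_mem hg) hgh)
    simpa using S.mul_mem (hS _ hgh) (S.inv_mem (hS _ hh))
  · exact hS g hg

/-- If an automorphism `g` fixes `z`, so does every element of the cyclic subgroup `⟨g⟩`.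
[folklore] -/
theorem R1.apply_eq_self_of_mem_zpowers {F V : Type*} [Field F] [Field V] [Algebra F V]
    {g : V ≃ₐ[F] V} {z : V} (hz : g z = z) {φ : V ≃ₐ[F] V} (hφ : φ ∈ Subgroup.zpowers g) :
    φ z = z := by
  have hle : Subgroup.zpowers g ≤ MulAction.stabilizer (V ≃ₐ[F] V) z := by
    rw [Subgroup.zpowers_le, MulAction.mem_stabilizer_iff]
    exact hz
  exact (MulAction.mem_stabilizer_iff.mp (hle hφ))

end Elementary

/-! ### §2 The lemma inside a finite Galois extension -/

section Core

variable {F V : Type*} [Field F] [Field V] [Algebra F V] {p : ℕ} [hp : Fact p.Prime]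

/-- **Twist-intersection lemma, core form (inside a finite Galois extension `V/F`).** Let `p` be a
prime such that `F` has NO primitive `p`-th root of unity (`z^p = 1 ⟹ z = 1` in `F`), `ζ ∈ V` a
primitive `p^A`-th root of unity (`A ≥ 1`), `a_i ≤ A`, `u_i ∈ F^×`, `x_i ∈ V` with
`x_i^{p^{a_i}} = u_i`. If `y ∈ V` is fixed by every `F`-automorphism `g` of `V` that fixes SOME
"twisted tuple" `(η_i x_i)_i` with `η_i^{p^{a_i}} = 1` — which is the case when `y` lies in
`F((η_i x_i)_i)` for EVERY such tuple — then EVERY `g ∈ Gal(V/F)` fixes `y`.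
PROOF (affine action on the roots): `gζ = ζ^c`, `g x_i = ζ_i^{d_i} x_i` with `ζ_i = ζ^{p^{A−a_i}}`;
if `g` moves `ζ_p = ζ^{p^{A−1}}` then `p ∤ c − 1`, the congruence `(c−1)t_i + d_i ≡ 0 (mod p^{a_i})`
is solvable and `g` fixes the tuple `(ζ_i^{t_i} x_i)_i`, hence `y`; the `g` fixing `ζ_p` form a
PROPER subgroup (`ζ_p ∉ F`, `V/F` Galois), and the complement of a proper subgroup generates.
[folklore] -/
theorem R1.forall_apply_eq_of_kummer_twists [FiniteDimensional F V] [IsGalois F V]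
    (hF : ∀ z : F, z ^ p = 1 → z = 1) {ι : Type*} (a : ι → ℕ) {A : ℕ} (hA : 0 < A)
    (ha : ∀ i, a i ≤ A) {ζ : V} (hζ : IsPrimitiveRoot ζ (p ^ A)) (u : ι → F) (hu : ∀ i, u i ≠ 0)
    (x : ι → V) (hx : ∀ i, x i ^ p ^ a i = algebraMap F V (u i)) {y : V}
    (hy : ∀ η : ι → V, (∀ i, η i ^ p ^ a i = 1) →
      ∀ g : V ≃ₐ[F] V, (∀ i, g (η i * x i) = η i * x i) → g y = y) :
    ∀ g : V ≃ₐ[F] V, g y = y := by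
  have hp' : p.Prime := hp.out
  haveI hneA : NeZero (p ^ A) := ⟨pow_ne_zero _ hp'.ne_zero⟩
  -- `ζ_p := ζ^{p^{A-1}}`, a primitive `p`-th root of unity in `V`
  set ζp : V := ζ ^ p ^ (A - 1) with hζp_def
  have hζp : IsPrimitiveRoot ζp p := by
    refine hζ.pow (pow_pos hp'.pos _) ?_
    rw [← pow_succ, Nat.sub_add_cancel hA]
  -- the subgroup `H` of automorphisms fixing `ζ_p` is proper
  set H : Subgroup (V ≃ₐ[F] V) := MulAction.stabilizer (V ≃ₐ[F] V) ζp with hH_def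
  have hHne : H ≠ ⊤ := by
    intro hH
    have hfix : ∀ g : V ≃ₐ[F] V, g ζp = ζp := fun g ↦
      MulAction.mem_stabilizer_iff.mp (hH ▸ Subgroup.mem_top g : g ∈ H)
    obtain ⟨z, hz⟩ := IntermediateField.mem_bot.mp ((IsGalois.mem_bot_iff_fixed ζp).mpr hfix)
    have hz1 : z ^ p = 1 :=
      (algebraMap F V).injective (by rw [map_pow, hz, map_one, hζp.pow_eq_one])
    exact hζp.ne_one hp'.one_lt (by rw [← hz, hF z hz1, map_one])
  -- every `g ∉ H` fixes `y`
  set S : Subgroup (V ≃ₐ[F] V) := MulAction.stabilizer (V ≃ₐ[F] V) y with hS_def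
  have hS : ∀ g, g ∉ H → g ∈ S := by
    intro g hg
    rw [hH_def, MulAction.mem_stabilizer_iff, AlgEquiv.smul_def] at hg
    rw [hS_def, MulAction.mem_stabilizer_iff, AlgEquiv.smul_def]
    -- `g ζ = ζ^c`
    obtain ⟨c, -, hc⟩ : ∃ c < p ^ A, ζ ^ c = g ζ :=
      hζ.eq_pow_of_pow_eq_one (by rw [← map_pow, hζ.pow_eq_one, map_one])
    -- `p ∤ c - 1`
    have hndvd : ¬ (p : ℤ) ∣ (c : ℤ) - 1 := by
      intro hdvd
      have h1 : ζp ^ ((c : ℤ) - 1) = 1 := (hζp.zpow_eq_one_iff_dvd _).mpr hdvd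
      rw [zpow_sub_one₀ (hζp.ne_zero hp'.ne_zero),
        mul_inv_eq_one₀ (hζp.ne_zero hp'.ne_zero)] at h1
      refine hg ?_
      calc g ζp = (g ζ) ^ p ^ (A - 1) := by rw [hζp_def, map_pow]
        _ = ζp ^ c := by rw [← hc, ← pow_mul, mul_comm, pow_mul]
        _ = ζp := by exact_mod_cast h1
    -- the induced primitive `p^{a_i}`-th roots `ζ_i`
    set ζi : ι → V := fun i ↦ ζ ^ p ^ (A - a i) with hζi_def
    have hζi : ∀ i, IsPrimitiveRoot (ζi i) (p ^ a i) := fun i ↦ by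
      refine hζ.pow (pow_pos hp'.pos _) ?_
      rw [← pow_add, Nat.sub_add_cancel (ha i)]
    have hgζi : ∀ i, g (ζi i) = ζi i ^ c := fun i ↦ by
      simp only [hζi_def, map_pow, ← hc]
      rw [← pow_mul, ← pow_mul, mul_comm]
    -- `x_i ≠ 0` and `g x_i = ζ_i^{d_i} x_i`
    have hx0 : ∀ i, x i ≠ 0 := fun i h0 ↦ by
      have := hx i
      rw [h0, zero_pow (pow_ne_zero _ hp'.ne_zero), eq_comm, map_eq_zero] at this
      exact hu i this
    have hd : ∀ i, ∃ d : ℕ, g (x i) = ζi i ^ d * x i := fun i ↦ by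
      haveI : NeZero (p ^ a i) := ⟨pow_ne_zero _ hp'.ne_zero⟩
      have hq : (g (x i) * (x i)⁻¹) ^ p ^ a i = 1 := by
        rw [mul_pow, ← map_pow, hx i, AlgEquiv.commutes, inv_pow, hx i,
          mul_inv_cancel₀]
        exact (_root_.map_ne_zero (algebraMap F V)).mpr (hu i)
      obtain ⟨d, -, hdq⟩ := (hζi i).eq_pow_of_pow_eq_one hq
      exact ⟨d, by rw [hdq, inv_mul_cancel_right₀ (hx0 i)]⟩
    choose d hd using hd
    -- Bézout: `α_i p^{a_i} + β_i (c - 1) = 1`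
    have hcop : ∀ i, IsCoprime ((p : ℤ) ^ a i) ((c : ℤ) - 1) := fun i ↦
      ((Prime.coprime_iff_not_dvd (Nat.prime_iff_prime_int.mp hp')).mpr hndvd).pow_left
    choose α β hαβ using hcop
    -- the twisted tuple fixed by `g`: `η_i := ζ_i^{t_i}`, `t_i := -d_i β_i`
    set t : ι → ℤ := fun i ↦ -((d i : ℤ) * β i) with ht_def
    set η : ι → V := fun i ↦ ζi i ^ t i with hη_def
    have hζi0 : ∀ i, ζi i ≠ 0 := fun i ↦ (hζi i).ne_zero (pow_ne_zero _ hp'.ne_zero)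
    have hη1 : ∀ i, η i ^ p ^ a i = 1 := fun i ↦ by
      rw [hη_def, ← zpow_natCast, ← zpow_mul, mul_comm, zpow_mul, zpow_natCast,
        (hζi i).pow_eq_one, one_zpow]
    have hfix : ∀ i, g (η i * x i) = η i * x i := fun i ↦ by
      have key : ((p : ℤ) ^ a i) ∣ ((c : ℤ) * t i + d i - t i) :=
        ⟨(d i : ℤ) * α i, by simp only [ht_def]; linear_combination (-(d i : ℤ)) * hαβ i⟩
      have hpow : ζi i ^ ((c : ℤ) * t i + d i) = ζi i ^ t i := by
        have h1 : ζi i ^ ((c : ℤ) * t i + d i - t i) = 1 := by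
          rw [(hζi i).zpow_eq_one_iff_dvd]
          exact_mod_cast key
        rwa [zpow_sub₀ (hζi0 i), div_eq_one_iff_eq (zpow_ne_zero _ (hζi0 i))] at h1
      simp only [hη_def, map_mul, map_zpow₀, hgζi, hd]
      rw [← mul_assoc]
      congr 1
      rw [← zpow_natCast (ζi i) c, ← zpow_mul, ← zpow_natCast (ζi i) (d i), ← zpow_add₀ (hζi0 i),
        hpow]
    exact hy η hη1 g hfix
  -- conclusion: `S = ⊤`
  have hS' : S = ⊤ := R1.subgroup_eq_top_of_forall_not_mem hHne hS
  exact fun g ↦ MulAction.mem_stabilizer_iff.mp (hS' ▸ Subgroup.mem_top g : g ∈ S)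

end Core

/-! ### §3 The lemma for an arbitrary extension `E/F` -/

section Extension

variable {F E : Type*} [Field F] [Field E] [Algebra F E] {p : ℕ} [hp : Fact p.Prime]

omit hp in
/-- A root `r ∈ E` of `X^{p^k} − c` with `c ∈ F^×` and `p ≠ char F` is separable over `F` (its
minimal polynomial divides the separable polynomial `X^{p^k} − c`). [folklore] -/
theorem R1.isSeparable_of_pow_eq_algebraMap (hpF : (p : F) ≠ 0) {k : ℕ} {c : F} (hc : c ≠ 0)
    {r : E} (hr : r ^ p ^ k = algebraMap F E c) : IsSeparable F r := by
  have hsep : (X ^ p ^ k - C c : F[X]).Separable :=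
    separable_X_pow_sub_C c (by exact_mod_cast pow_ne_zero k hpF) hc
  refine hsep.of_dvd (minpoly.dvd F r ?_)
  simp [hr]

/-- **Twist-intersection lemma (arbitrary extension `E/F`, finitely many radicals).** Let `p` be a
prime such that `F` has NO primitive `p`-th root of unity, `E ⊇ F` a field containing a primitive
`p^A`-th root of unity `ζ`, `a_i ≤ A` (`i` in a finite index set), `u_i ∈ F^×` and `x_i ∈ E` with
`x_i^{p^{a_i}} = u_i`. If `y ∈ E` lies in `F((η_i x_i)_i)` for EVERY tuple `(η_i)` of `p^{a_i}`-th
roots of unity, then `y ∈ F`:  `⋂_{(η_i)} F((η_i x_i)_i) = F`. (The fields `F((η_i x_i)_i)` are the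
conjugates `σ F((x_i)_i)`; for `p = 2` the statement is false — `F(√u) = F(−√u)` — and indeed
`−1 ∈ F` is a primitive square root of unity unless `char F = 2`.) Reduction to the core form
`R1.forall_apply_eq_of_kummer_twists` inside the splitting field `V ⊆ E` of
`(X^{p^A} − 1)·∏_i (X^{p^{a_i}} − u_i)` over `F`, which is finite Galois (normal as a splitting
field; separable because `p ≠ char F`, forced by the existence of `ζ` when `A ≥ 1`). [folklore] -/
theorem R1.mem_bot_of_forall_mem_adjoin_kummer_twists (hF : ∀ z : F, z ^ p = 1 → z = 1)
    {ι : Type*} [Finite ι] (a : ι → ℕ) {A : ℕ} (ha : ∀ i, a i ≤ A) {ζ : E}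
    (hζ : IsPrimitiveRoot ζ (p ^ A)) (u : ι → F) (hu : ∀ i, u i ≠ 0) (x : ι → E)
    (hx : ∀ i, x i ^ p ^ a i = algebraMap F E (u i)) {y : E}
    (hy : ∀ η : ι → E, (∀ i, η i ^ p ^ a i = 1) →
      y ∈ IntermediateField.adjoin F (Set.range fun i ↦ η i * x i)) :
    y ∈ (⊥ : IntermediateField F E) := by
  have hp' : p.Prime := hp.out
  rcases Nat.eq_zero_or_pos A with rfl | hA
  · -- all `a i = 0`: then `x i = u i ∈ F`
    have ha0 : ∀ i, a i = 0 := fun i ↦ Nat.le_zero.mp (ha i)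
    refine (IntermediateField.adjoin_le_iff.mpr ?_) (hy (fun _ ↦ 1) (fun i ↦ one_pow _))
    rintro _ ⟨i, rfl⟩
    have hxi : x i = algebraMap F E (u i) := by simpa [ha0 i] using hx i
    simp only [one_mul, hxi, SetLike.mem_coe]
    exact (⊥ : IntermediateField F E).algebraMap_mem (u i)
  -- `A ≥ 1`: the characteristic is not `p`
  haveI : NeZero (p ^ A) := ⟨pow_ne_zero _ hp'.ne_zero⟩
  have hpE : (p : E) ≠ 0 := ne_zero_pow hA.ne' (by simpa [Nat.cast_pow] using (hζ.neZero').out)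
  have hpF : (p : F) ≠ 0 := fun h ↦ hpE (by rw [← map_natCast (algebraMap F E), h, map_zero])
  -- the polynomial `f` and its splitting field `V ⊆ E`
  haveI := Fintype.ofFinite ι
  set f : F[X] := (X ^ p ^ A - C 1) * ∏ i, (X ^ p ^ a i - C (u i)) with hf_def
  have hf0 : f ≠ 0 :=
    mul_ne_zero (X_pow_sub_C_ne_zero (pow_pos hp'.pos _) _)
      (Finset.prod_ne_zero_iff.mpr fun i _ ↦ X_pow_sub_C_ne_zero (pow_pos hp'.pos _) _)
  have hζi : ∀ i, IsPrimitiveRoot (ζ ^ p ^ (A - a i)) (p ^ a i) := fun i ↦ by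
    refine hζ.pow (pow_pos hp'.pos _) ?_
    rw [← pow_add, Nat.sub_add_cancel (ha i)]
  have hsplit : (f.map (algebraMap F E)).Splits := by
    simp only [hf_def, Polynomial.map_mul, Polynomial.map_prod, Polynomial.map_sub,
      Polynomial.map_pow, map_X, map_C, map_one]
    refine Splits.mul ?_ (Splits.prod fun i _ ↦ ?_)
    · simpa using X_pow_sub_C_splits_of_isPrimitiveRoot hζ (one_pow (p ^ A))
    · exact X_pow_sub_C_splits_of_isPrimitiveRoot (hζi i) (hx i)
  have hmem : ∀ r : E,
      r ∈ f.rootSet E ↔ (r ^ p ^ A = 1 ∨ ∃ i, r ^ p ^ a i = algebraMap F E (u i)) := by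
    intro r
    rw [mem_rootSet_of_ne hf0]
    simp only [hf_def, map_mul, map_prod, map_sub, map_pow, aeval_X, aeval_C, map_one,
      mul_eq_zero, Finset.prod_eq_zero_iff, Finset.mem_univ, true_and, sub_eq_zero]
  set V : IntermediateField F E := IntermediateField.adjoin F (f.rootSet E) with hV_def
  haveI hSF : f.IsSplittingField F V := IntermediateField.adjoin_rootSet_isSplittingField hsplit
  haveI : Normal F V := Normal.of_isSplittingField f
  haveI : FiniteDimensional F V := Polynomial.IsSplittingField.finiteDimensional V f
  haveI : Algebra.IsSeparable F V := by
    refine (IntermediateField.isSeparable_adjoin_iff_isSeparable F _).mpr fun r hr ↦ ?_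
    rcases (hmem r).mp hr with h1 | ⟨i, hi⟩
    · exact R1.isSeparable_of_pow_eq_algebraMap hpF one_ne_zero (by rw [h1, map_one])
    · exact R1.isSeparable_of_pow_eq_algebraMap hpF (hu i) hi
  haveI : IsGalois F V := ⟨⟩
  -- the data seen inside `V`
  have hζV : ζ ∈ V := IntermediateField.subset_adjoin F _ ((hmem ζ).mpr (Or.inl hζ.pow_eq_one))
  have hxV : ∀ i, x i ∈ V := fun i ↦
    IntermediateField.subset_adjoin F _ ((hmem _).mpr (Or.inr ⟨i, hx i⟩))
  have hyV : y ∈ V := by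
    refine (IntermediateField.adjoin.mono F _ _ ?_) (hy (fun _ ↦ 1) (fun _ ↦ one_pow _))
    rintro _ ⟨i, rfl⟩
    simpa only [one_mul] using (hmem _).mpr (Or.inr ⟨i, hx i⟩)
  set ζ' : V := ⟨ζ, hζV⟩ with hζ'_def
  set x' : ι → V := fun i ↦ ⟨x i, hxV i⟩ with hx'_def
  set y' : V := ⟨y, hyV⟩ with hy'_def
  have hζ' : IsPrimitiveRoot ζ' (p ^ A) := IsPrimitiveRoot.coe_submonoidClass_iff.mp hζ
  have hx' : ∀ i, x' i ^ p ^ a i = algebraMap F V (u i) := fun i ↦ by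
    apply Subtype.ext
    simp [hx'_def, hx i]
  have hy' : ∀ η : ι → V, (∀ i, η i ^ p ^ a i = 1) →
      ∀ g : V ≃ₐ[F] V, (∀ i, g (η i * x' i) = η i * x' i) → g y' = y' := by
    intro η hη g hg
    have hηE : ∀ i, (η i : E) ^ p ^ a i = 1 := fun i ↦ by
      simpa using congrArg (fun v : V ↦ (v : E)) (hη i)
    -- `y' ∈ F((η_i x_i)_i)` inside `V` (transport along `V ↪ E` by `lift`)
    have hyad : y' ∈ IntermediateField.adjoin F (Set.range fun i ↦ η i * x' i) := by
      have hset : (Subtype.val ∘ fun i ↦ η i * x' i) = fun i ↦ (η i : E) * x i := by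
        funext i
        simp [hx'_def]
      rw [← IntermediateField.mem_lift y', IntermediateField.lift_adjoin, ← Set.range_comp, hset]
      exact hy (fun i ↦ (η i : E)) hηE
    -- that field is fixed pointwise by `g`
    have hle : IntermediateField.adjoin F (Set.range fun i ↦ η i * x' i) ≤
        IntermediateField.fixedField (Subgroup.zpowers g) := by
      rw [IntermediateField.adjoin_le_iff]
      rintro _ ⟨i, rfl⟩
      rw [SetLike.mem_coe, IntermediateField.mem_fixedField_iff]
      exact fun φ hφ ↦ R1.apply_eq_self_of_mem_zpowers (hg i) hφ
    exact ((IntermediateField.mem_fixedField_iff _ _).mp (hle hyad)) g (Subgroup.mem_zpowers g)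
  -- the core lemma in `V`, and back to `E`
  have hall := R1.forall_apply_eq_of_kummer_twists hF a hA ha hζ' u hu x' hx' hy'
  obtain ⟨z, hz⟩ := IntermediateField.mem_bot.mp ((IsGalois.mem_bot_iff_fixed y').mpr hall)
  refine IntermediateField.mem_bot.mpr ⟨z, ?_⟩
  simpa [hy'_def, IntermediateField.algebraMap_apply] using congrArg (fun v : V ↦ (v : E)) hz

/-! ### §4 Corollaries: one radical; the `⨅` form; subfields of an ambient field -/

/-- **One radical**: `F` without primitive `p`-th root of unity, `ζ ∈ E` a primitive `p^a`-th root
of unity, `x^{p^a} = u ∈ F^×`; if `y ∈ F(ηx)` for every `p^a`-th root of unity `η ∈ E`, then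
`y ∈ F` — i.e. `⋂_η F(ηx) = F`, the intersection of ALL the conjugate fields `F(x')`,
`x'^{p^a} = u`. (The case `m = 1` of `R1.mem_bot_of_forall_mem_adjoin_kummer_twists`; at `p = 3`
this is the shape used for ONE character value `u = λ̂(γ)`.) [folklore] -/
theorem R1.mem_bot_of_forall_mem_adjoin_rootOfUnity_mul (hF : ∀ z : F, z ^ p = 1 → z = 1)
    {a : ℕ} {ζ : E} (hζ : IsPrimitiveRoot ζ (p ^ a)) {u : F} (hu : u ≠ 0) {x : E}
    (hx : x ^ p ^ a = algebraMap F E u) {y : E} (hy : ∀ η : E, η ^ p ^ a = 1 → y ∈ F⟮η * x⟯) :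
    y ∈ (⊥ : IntermediateField F E) :=
  R1.mem_bot_of_forall_mem_adjoin_kummer_twists hF (ι := Unit) (fun _ ↦ a) (A := a)
    (fun _ ↦ le_rfl) hζ (fun _ ↦ u) (fun _ ↦ hu) (fun _ ↦ x) (fun _ ↦ hx) fun η hη ↦ by
      simpa [Set.range_unique] using hy (η default) (hη default)

/-- **`⨅_η F(ηx) = ⊥`** over the `p^a`-th roots of unity `η ∈ E` (lattice form of
`R1.mem_bot_of_forall_mem_adjoin_rootOfUnity_mul`). [folklore] -/
theorem R1.iInf_adjoin_rootOfUnity_mul_eq_bot (hF : ∀ z : F, z ^ p = 1 → z = 1) {a : ℕ} {ζ : E}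
    (hζ : IsPrimitiveRoot ζ (p ^ a)) {u : F} (hu : u ≠ 0) {x : E}
    (hx : x ^ p ^ a = algebraMap F E u) :
    ⨅ η : {η : E // η ^ p ^ a = 1}, F⟮(η : E) * x⟯ = ⊥ := by
  refine le_antisymm (fun y hy ↦ ?_) bot_le
  exact R1.mem_bot_of_forall_mem_adjoin_rootOfUnity_mul hF hζ hu hx fun η hη ↦
    (iInf_le (fun η : {η : E // η ^ p ^ a = 1} ↦ F⟮(η : E) * x⟯) ⟨η, hη⟩) hy

/-- **Subfield form (inside one ambient field `Ω`, e.g. `Ω = ℂ_p`).** `L ⊆ Ω` a subfield without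
primitive `p`-th root of unity, `ζ ∈ Ω` a primitive `p^a`-th root of unity, `u ∈ L ∖ {0}`,
`x^{p^a} = u`; if `y` lies in the subfield generated by `L` and `ηx` for every `p^a`-th root of
unity `η`, then `y ∈ L`. This is the form consumed by a descent of COEFFICIENTS: with
`L = Frac R₀ ⊂ ℂ_p` (`R₀ = 𝒪(\widehat{ℚ_p^ur})`, `p` odd, so `ζ_p ∉ L` as `L(ζ_p)/L` is totally
ramified of degree `p − 1`) and `u` a principal unit, a power series whose coefficients lie in
`L(ηu^{1/p^a})` for every `η` has its coefficients in `L` — STEP B of the `R₀`-descent behind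
"`L_p(f) ∈ Λ_{R₀}`" (Castella 2018, p. 9 ll. 42–47, the twist `Tw_{ψ⁻¹}`); the facts about `R₀`
(`ζ_p ∉ Frac R₀`) are NOT proved here. [folklore] -/
theorem R1.mem_subfield_of_forall_mem_closure {Ω : Type*} [Field Ω] (L : Subfield Ω)
    (hL : ∀ z ∈ L, z ^ p = 1 → z = 1) {a : ℕ} {ζ : Ω} (hζ : IsPrimitiveRoot ζ (p ^ a)) {u : Ω}
    (huL : u ∈ L) (hu : u ≠ 0) {x : Ω} (hx : x ^ p ^ a = u) {y : Ω}
    (hy : ∀ η : Ω, η ^ p ^ a = 1 → y ∈ Subfield.closure ((L : Set Ω) ∪ {η * x})) : y ∈ L := by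
  have hF : ∀ z : L, z ^ p = 1 → z = 1 := fun z hz ↦
    Subtype.ext (hL z z.2 (by simpa using congrArg (fun w : L ↦ (w : Ω)) hz))
  have hu' : (⟨u, huL⟩ : L) ≠ 0 := fun h ↦ hu (by simpa using congrArg (fun w : L ↦ (w : Ω)) h)
  have hx' : x ^ p ^ a = algebraMap L Ω ⟨u, huL⟩ := by simpa [Subfield.algebraMap_ofSubfield]
  have hrange : Set.range (algebraMap L Ω) = (L : Set Ω) :=
    Set.ext fun w ↦ ⟨by rintro ⟨z, rfl⟩; exact z.2, fun hw ↦ ⟨⟨w, hw⟩, rfl⟩⟩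
  have hy' : ∀ η : Ω, η ^ p ^ a = 1 → y ∈ L⟮η * x⟯ := fun η hη ↦ by
    rw [← IntermediateField.mem_toSubfield, IntermediateField.adjoin_toSubfield, hrange]
    exact hy η hη
  obtain ⟨z, hz⟩ := IntermediateField.mem_bot.mp
    (R1.mem_bot_of_forall_mem_adjoin_rootOfUnity_mul hF hζ hu' hx' hy')
  rw [← hz, Subfield.algebraMap_ofSubfield]
  exact z.2

end Extension

end Summit.BirchSwinnertonDyer.Rank1Residual.X11b

end
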